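import Literature.Geometry.Lorentzian.KerrConvergence
import Literature.Geometry.Lorentzian.ConvergenceTransport
import HarnessLib

set_option linter.dupNamespace false

/-!
# Stub `stub_softShieldedDecomposition` of line `Sketch` of crux `CaptureSufficesC2`
# (stmt-FinalStateConjecture-14986, route `PhaseMixingCapture`) — companion: what the capture block
# actually hands over (typed gap B2, consumer side)

`CaptureAtC2` (the conclusion block of `BulkKerrCaptureC2`) concludes
`∃ M' a' 𝒟oc, … ∧ 𝒟'.ConvergesToKerr 𝒟oc M' a' 2 ∧ …` for the maximal development `𝒟'` of the leaf
datum. Two kernel-checked readings of the definitions `Spacetime.IsLateChart/IsLateEmbedding/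
ConvergesTo` (`KerrConvergence.lean`):

* `exists_convergesTo_iff`, `exists_convergesToKerr_iff` — **the `∃ 𝒟oc` form is coverage-void**:
  `∃ 𝒟oc, ConvergesTo B 𝒟oc k` is EQUIVALENT to "some smooth map `Ψ : B.domain → 𝓢`, an open
  embedding of the late region `{t > τ₀}`, has full-slab `Cᵏ` deviation `→ 0`" (take
  `𝒟oc := Ψ({t > τ₀})`; the covering clause becomes `∅ ⊆ _`). Nothing about WHICH region is charted
  or about the chart's time orientation survives the existential — which is why an `o(1)`-shifted
  chart on exact Kerr is a legitimate witness missing a sliver of the true exterior at every late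
  time (ideator 2's B2), and why `HasExhaustiveCharts` (charts reach the true event horizon, chart
  time agrees with causal order on `O`) is not assembled from it.
* `IsLateEmbedding.image_comp`, `ConvergesTo.image_comp`, `convergesToKerr_of_realised` —
  **transport along Stub 2's realisation `χ : 𝒟' → 𝓜`** (smooth, open embedding, isometric
  immersion, time-orientation preserving; NO surjectivity): the capture chart `Ψ` of `𝒟'` gives the
  chart `χ ∘ Ψ` of `𝓜` for the region `χ(𝒟oc)` with the SAME deviation function
  (`Spacetime.deviation_comp`), the covering clause transported by injectivity and
  `LorentzianMetric.image_causalPast_subset`. So `CaptureAtC2` + Stub 2 hand Stub 4 exactly a WEAK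
  chart in `𝓜`; the residual gap of Stub 4 is "weak chart in `𝓜` ⟹ strong chart in `𝓜`" (bending
  above `ι X`, red-shift strip control + horizon normalisation, exhaustion), consumed by
  `exists_settlingDecomposition_of_strongChart` of the main file.

No definitions, no named facts, no `sorry`; axioms standard.

References: M. Dafermos, G. Holzegel, I. Rodnianski, M. Taylor, arXiv:2104.08222, §1 (consequence
form of convergence, as vendored in `KerrConvergence`); B. O'Neill, *Semi-Riemannian geometry*
(1983), Ch. 3, p. 58, Ch. 14, pp. 402–403; M. Dafermos, J. Luk, arXiv:1710.01722, Conjecture 1.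
-/

noncomputable section

namespace Summit.FinalStateConjecture.FinalStateConjecture.Theorems.CaptureSufficesC2.Sketch

open Set Filter Function Topology
open scoped Manifold ContDiff Topology
open Literature.Geometry.Lorentzian

/-! ## §3 What the capture block DOES hand over: the `∃ 𝒟oc` chart, and its transport into `𝓜` -/

section Weak

variable {𝓢₀ 𝓢 : Spacetime.{0} 4}

/-- **The `∃ 𝒟oc` form is coverage-void** (typed gap B2, consumer side): for the SELF-CHARTED
region `𝒟oc := Ψ({t > τ₀})` the covering clause of `IsLateEmbedding` is empty, so a late-time
EMBEDDING for that region is nothing more than a smooth map which is an open embedding of the late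
region. Field-by-field reading of `Spacetime.IsLateChart`/`IsLateEmbedding` (DHRT arXiv:2104.08222,
§1, consequence form as vendored in `KerrConvergence`). [cite: arXiv210408222, §1] -/
theorem isLateEmbedding_image_iff (B : ModelBackground) {τ₀ : ℝ} {Ψ : B.domain → 𝓢.carrier} :
    𝓢.IsLateEmbedding B (Ψ '' B.lateRegion τ₀) τ₀ Ψ ↔
      ContMDiff 𝓘(ℝ, E4) (𝓡 4) ∞ Ψ ∧ IsOpenEmbedding ((B.lateRegion τ₀).restrict Ψ) :=
  ⟨fun h ↦ ⟨h.contMDiff, h.isOpenEmbedding⟩,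
    fun h ↦ ⟨⟨h.1, h.2, subset_rfl⟩, fun _ hx ↦ (hx.2 hx.1).elim⟩⟩

/-- **`∃ 𝒟oc, ConvergesTo B 𝒟oc k` says exactly: some smooth open late chart has decaying
full-slab `Cᵏ` deviation** — no statement about WHICH region is charted survives the existential
(take `𝒟oc := Ψ({t > τ₀})`). This is the precise content a consumer of `BulkKerrCaptureC2` /
`CaptureAtC2` receives (typed gap B2). DHRT arXiv:2104.08222, §1. [cite: arXiv210408222, §1] -/
theorem exists_convergesTo_iff (B : ModelBackground) (k : ℕ) :
    (∃ 𝒟oc : Set 𝓢.carrier, 𝓢.ConvergesTo B 𝒟oc k) ↔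
      ∃ (τ₀ : ℝ) (Ψ : B.domain → 𝓢.carrier), ContMDiff 𝓘(ℝ, E4) (𝓡 4) ∞ Ψ ∧
        IsOpenEmbedding ((B.lateRegion τ₀).restrict Ψ) ∧
          Tendsto (fun τ ↦ 𝓢.deviationCk B Ψ k τ) atTop (𝓝 0) := by
  constructor
  · rintro ⟨𝒟oc, τ₀, Ψ, hΨ, ht⟩
    exact ⟨τ₀, Ψ, hΨ.contMDiff, hΨ.isOpenEmbedding, ht⟩
  · rintro ⟨τ₀, Ψ, hs, he, ht⟩
    exact ⟨Ψ '' B.lateRegion τ₀, τ₀, Ψ, (isLateEmbedding_image_iff B).2 ⟨hs, he⟩, ht⟩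

/-- The Kerr specialisation: `∃ 𝒟oc, ConvergesToKerr 𝒟oc M a k` is "some smooth open late
Kerr–Schild chart has decaying full-slab `Cᵏ` deviation from `g_{M,a}`", nothing more
(typed gap B2). DHRT arXiv:2104.08222, §1. [cite: arXiv210408222, §1] -/
theorem exists_convergesToKerr_iff (M a : ℝ) (k : ℕ) :
    (∃ 𝒟oc : Set 𝓢.carrier, 𝓢.ConvergesToKerr 𝒟oc M a k) ↔
      ∃ (τ₀ : ℝ) (Ψ : (Kerr.background M a).domain → 𝓢.carrier), ContMDiff 𝓘(ℝ, E4) (𝓡 4) ∞ Ψ ∧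
        IsOpenEmbedding ((Kerr.lateRegion M a τ₀).restrict Ψ) ∧
          Tendsto (fun τ ↦ 𝓢.deviationCk (Kerr.background M a) Ψ k τ) atTop (𝓝 0) :=
  exists_convergesTo_iff (Kerr.background M a) k

/-- **Late-time embeddings push forward along isometric open embeddings** (no surjectivity):
if `Ψ` is a late-time embedding for `𝒟oc ⊆ 𝓢₀` and `χ : 𝓢₀ → 𝓢` is a smooth, time-orientation
preserving, isometric open embedding, then `χ ∘ Ψ` is a late-time embedding for `χ(𝒟oc) ⊆ 𝓢`:
`χ(𝒟oc) ∖ χΨ({t > τ₀}) = χ(𝒟oc ∖ Ψ({t > τ₀})) ⊆ χ(J⁻(Ψ{t = τ₀})) ⊆ J⁻(χΨ{t = τ₀})`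
(injectivity and `LorentzianMetric.image_causalPast_subset`). Generalises
`IsLateEmbedding.comp_of_surjective` (`ConvergenceTransport`). O'Neill 1983, Ch. 14, pp. 402–403.
[cite: ONeill1983, Ch. 14, pp. 402–403] -/
theorem IsLateEmbedding.image_comp (B : ModelBackground) {𝒟oc : Set 𝓢₀.carrier} {τ₀ : ℝ}
    {Ψ : B.domain → 𝓢₀.carrier} (hΨ : 𝓢₀.IsLateEmbedding B 𝒟oc τ₀ Ψ)
    {χ : 𝓢₀.carrier → 𝓢.carrier} (hχs : ContMDiff (𝓡 4) (𝓡 4) ∞ χ) (hχo : IsOpenEmbedding χ)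
    (hχg : ∀ y, pullbackBilin (I := 𝓡 4) (I' := 𝓡 4) χ 𝓢.metric.val y = 𝓢₀.metric.val y)
    (hχτ : 𝓢₀.timeOrientation.PreservesTimeOrientation χ 𝓢.timeOrientation) :
    𝓢.IsLateEmbedding B (χ '' 𝒟oc) τ₀ (χ ∘ Ψ) where
  contMDiff := hχs.comp hΨ.contMDiff
  isOpenEmbedding := hχo.comp hΨ.isOpenEmbedding
  image_subset := by
    rw [Set.image_comp]
    exact image_mono hΨ.image_subset
  diff_subset_causalPast := by
    rintro x ⟨⟨x₀, hx₀, rfl⟩, hx⟩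
    have hx₀' : x₀ ∉ Ψ '' B.lateRegion τ₀ := fun ⟨z, hz, hzx⟩ ↦ hx ⟨z, hz, by simp [← hzx]⟩
    have h := hΨ.diff_subset_causalPast ⟨hx₀, hx₀'⟩
    have h' := LorentzianMetric.image_causalPast_subset (hχs.mdifferentiable (by simp)) hχτ hχg
      (Ψ '' B.timeSlab τ₀) (mem_image_of_mem χ h)
    rwa [image_image] at h'

/-- **Convergence to a background pushes forward along isometric open embeddings**, with the
SAME deviation function (`Spacetime.deviation_comp`): `𝓢₀.ConvergesTo B 𝒟oc k` gives
`𝓢.ConvergesTo B (χ(𝒟oc)) k` in the chart `χ ∘ Ψ`. DHRT arXiv:2104.08222, §1 (consequence form).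
[cite: arXiv210408222, §1] -/
theorem ConvergesTo.image_comp (B : ModelBackground) {𝒟oc : Set 𝓢₀.carrier} {k : ℕ}
    (h : 𝓢₀.ConvergesTo B 𝒟oc k)
    {χ : 𝓢₀.carrier → 𝓢.carrier} (hχs : ContMDiff (𝓡 4) (𝓡 4) ∞ χ) (hχo : IsOpenEmbedding χ)
    (hχg : ∀ y, pullbackBilin (I := 𝓡 4) (I' := 𝓡 4) χ 𝓢.metric.val y = 𝓢₀.metric.val y)
    (hχτ : 𝓢₀.timeOrientation.PreservesTimeOrientation χ 𝓢.timeOrientation) :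
    𝓢.ConvergesTo B (χ '' 𝒟oc) k := by
  obtain ⟨τ₀, Ψ, hΨ, ht⟩ := h
  refine ⟨τ₀, χ ∘ Ψ, IsLateEmbedding.image_comp B hΨ hχs hχo hχg hχτ, ?_⟩
  have hdev : 𝓢.deviationCk B (χ ∘ Ψ) k = 𝓢₀.deviationCk B Ψ k := by
    funext τ
    unfold Spacetime.deviationCk Spacetime.deviationExtend
    rw [Spacetime.deviation_comp B (hχs.mdifferentiable (by simp)) hχg
      (hΨ.contMDiff.mdifferentiable (by simp))]
  rw [hdev]
  exact ht

/-- **What `CaptureAtC2` + Stub 2 hand to Stub 4, and no more**: if the maximal development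
`𝒟'` of the leaf datum is REALISED inside `𝓜` by `χ` (the conclusion shape of
`stub_hypersurfaceMGHDRealised`: smooth open embedding, isometric immersion, time-orientation
preserving) and the capture block gives `𝒟'.ConvergesToKerr 𝒟oc M' a' k`, then `𝓜` converges to
the same Kerr in the transported chart, `𝓜.ConvergesToKerr (χ(𝒟oc)) M' a' k` — again an
`∃`-region statement, coverage-void by `exists_convergesToKerr_iff`. The residual gap of Stub 4 is
therefore exactly "weak chart in `𝓜` ⟹ strong chart in `𝓜`" (bending above `ι X`, red-shift strip
control and horizon normalisation, exhaustion). DHRT arXiv:2104.08222, §1.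
[cite: arXiv210408222, §1] -/
theorem convergesToKerr_of_realised {𝒟oc : Set 𝓢₀.carrier} {M' a' : ℝ} {k : ℕ}
    (h : 𝓢₀.ConvergesToKerr 𝒟oc M' a' k) {χ : 𝓢₀.carrier → 𝓢.carrier}
    (hχs : ContMDiff (𝓡 4) (𝓡 4) ∞ χ) (hχo : IsOpenEmbedding χ)
    (hχg : 𝓢₀.metric.IsIsometricImmersion 𝓢.metric.toPseudoRiemannianMetric χ)
    (hχτ : 𝓢₀.timeOrientation.PreservesTimeOrientation χ 𝓢.timeOrientation) :
    𝓢.ConvergesToKerr (χ '' 𝒟oc) M' a' k :=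
  ConvergesTo.image_comp (Kerr.background M' a') h hχs hχo hχg.2 hχτ

/-- **Registered sub-stub `stub_softShieldedDecomposition_weakTransport`** (= `convergesToKerr_of_realised`
in closed `∀`-form): what `CaptureAtC2` + Stub 2 hand to Stub 4 — the capture chart of a realised
sub-development transports along the realisation `χ` to a WEAK (`∃`-region) chart of the ambient
development, same Kerr, same order. DHRT arXiv:2104.08222, §1. [cite: arXiv210408222, §1] -/
theorem stub_softShieldedDecomposition_weakTransport : ∀ (𝓢₀ 𝓢 : Spacetime.{0} 4) (𝒟oc : Set 𝓢₀.carrier) (M' a' : ℝ) (k : ℕ), 𝓢₀.ConvergesToKerr 𝒟oc M' a' k → ∀ (χ : 𝓢₀.carrier → 𝓢.carrier), ContMDiff (𝓡 4) (𝓡 4) ∞ χ → Topology.IsOpenEmbedding χ → 𝓢₀.metric.IsIsometricImmersion 𝓢.metric.toPseudoRiemannianMetric χ → 𝓢₀.timeOrientation.PreservesTimeOrientation χ 𝓢.timeOrientation → 𝓢.ConvergesToKerr (χ '' 𝒟oc) M' a' k :=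
  fun _ _ _ _ _ _ h _ hχs hχo hχg hχτ ↦ convergesToKerr_of_realised h hχs hχo hχg hχτ

end Weak

end Summit.FinalStateConjecture.FinalStateConjecture.Theorems.CaptureSufficesC2.Sketch

end
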